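import Literature.Probability.Percolation.ConditionalPositiveAssociationProofs
import HarnessLib

/-!
# Product weights versus sub-cubes of colourings of a MULTIGRAPH (the bridge behind CELL-PA, general `ends`)

Support file (`--supports stmt-CriticalPhenomena-4575`, closed), prover `prim-lf-2` (gen 32).  No definitions, no named facts, no sorries;
standard axioms.  Companion of `…CoefficientwiseCellPA` (simple graphs) — memo `prim-lf-2/CW-POINTS-gen32.md` §5.

For a finite multigraph `ends : ι → Sym2 V`, a set `B₀` of surely-open edges and a disjoint set `E₁` of free edges (all other edges closed),
the uniform colouring `t ⊆ E₁` induces on the PAIR configuration `ends '' (B₀ ∪ t) ⊆ Sym2 V` the product law with parameters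
  `w(e) = 1` if some edge of `B₀` has ends `e`, else `1 − 2^{−#{i ∈ E₁ : ends i = e}}`
(a pair is open iff at least one of its parallel copies is).  In the finite-sum language of `Literature…BHK2006`:
* `Coefficientwise.sum_subcube_eq_weight` — `Σ_{t ⊆ E₁} φ(ends '' (B₀ ∪ t)) = 2^{|E₁|} · Σ_{ω : Set (Sym2 V)} BHK2006.weight w ω · φ ω`.
Tools: `weight_eq_mul_erase` (split off one coordinate of a product weight), `sum_pairs` (pair `η` with `insert e η`),
`sum_weight_resample` (resampling one coordinate with a new bias: for `w, w'` agreeing off `e`,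
`Σ_ω weight w' ω · h ω = Σ_ω weight w ω · ((1 − w' e)·h(ω ∖ {e}) + w' e·h(insert e ω))`), `sum_weight_indicator` (a `{0,1}`-valued
parameter vector concentrates the weight on one configuration).  Proof of the bridge: induction on `E₁`.
[cite: VandenbergHaggstromKahn2005, §1 p. 2 (bond percolation with arbitrary edge probabilities `p_e`)]
-/

noncomputable section

open Finset
open Literature.Probability.Percolation
open Literature.Probability.Percolation.BHK2006

namespace Summit.CriticalPhenomena.PercolationContinuityZ3.Theorems

namespace Coefficientwise

open scoped Classical

section Weights

variable {α : Type*} [Fintype α]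

/-- Splitting off the coordinate `e` of a product weight. [folklore] -/
theorem weight_eq_mul_erase (w : α → ℝ) (e : α) (ω : Set α) :
    weight w ω = (if e ∈ ω then w e else 1 - w e) *
      ∏ e' ∈ (Finset.univ : Finset α).erase e, (if e' ∈ ω then w e' else 1 - w e') := by
  unfold weight
  rw [Finset.mul_prod_erase (Finset.univ : Finset α) (fun e' => if e' ∈ ω then w e' else 1 - w e') (Finset.mem_univ e)]

/-- The part of the product weight off `e` does not see the coordinate `e` nor the parameter at `e`. [folklore] -/
theorem prod_erase_congr (w w' : α → ℝ) (e : α) (hww' : ∀ e', e' ≠ e → w' e' = w e') (ω ω' : Set α)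
    (hωω' : ∀ e', e' ≠ e → (e' ∈ ω' ↔ e' ∈ ω)) :
    ∏ e' ∈ (Finset.univ : Finset α).erase e, (if e' ∈ ω' then w' e' else 1 - w' e')
      = ∏ e' ∈ (Finset.univ : Finset α).erase e, (if e' ∈ ω then w e' else 1 - w e') := by
  refine Finset.prod_congr rfl fun e' he' => ?_
  have hne : e' ≠ e := Finset.ne_of_mem_erase he'
  rw [hww' e' hne]
  by_cases h : e' ∈ ω
  · rw [if_pos h, if_pos ((hωω' e' hne).2 h)]
  · rw [if_neg h, if_neg (fun h' => h ((hωω' e' hne).1 h'))]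

/-- Pairing `η ∌ e` with `insert e η`: a sum over all configurations is the sum over the pairs. [folklore] -/
theorem sum_pairs (F : Set α → ℝ) (e : α) :
    ∑ ω : Set α, F ω = ∑ η ∈ (Finset.univ : Finset (Set α)).filter (fun η => e ∉ η), (F η + F (insert e η)) := by
  rw [Finset.sum_add_distrib]
  rw [← Finset.sum_filter_add_sum_filter_not (Finset.univ : Finset (Set α)) (fun ω : Set α => e ∉ ω) F]
  congr 1
  -- the configurations containing `e` are the `insert e η`, `e ∉ η`
  refine Finset.sum_bij' (fun ω _ => ω \ {e}) (fun η _ => insert e η) ?_ ?_ ?_ ?_ ?_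
  · intro ω hω
    simp only [Finset.mem_filter, Finset.mem_univ, true_and, Set.mem_sdiff, Set.mem_singleton_iff, not_true_eq_false,
      and_false, not_false_eq_true]
  · intro η hη
    simp only [Finset.mem_filter, Finset.mem_univ, true_and, not_not, Set.mem_insert_iff, true_or]
  · intro ω hω
    have he : e ∈ ω := by simpa using hω
    ext e'
    simp only [Set.mem_insert_iff, Set.mem_sdiff, Set.mem_singleton_iff]
    constructor
    · rintro (rfl | ⟨h, _⟩)
      · exact he
      · exact h
    · intro h
      by_cases hee : e' = e
      · exact Or.inl hee
      · exact Or.inr ⟨h, hee⟩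
  · intro η hη
    have he : e ∉ η := by simpa using hη
    ext e'
    simp only [Set.mem_sdiff, Set.mem_insert_iff, Set.mem_singleton_iff]
    constructor
    · rintro ⟨rfl | h, hne⟩
      · exact absurd rfl hne
      · exact h
    · intro h
      exact ⟨Or.inr h, fun hee => he (hee ▸ h)⟩
  · intro ω hω
    have he : e ∈ ω := by simpa using hω
    congr 1
    ext e'
    simp only [Set.mem_insert_iff, Set.mem_sdiff, Set.mem_singleton_iff]
    constructor
    · intro h
      by_cases hee : e' = e
      · exact Or.inl hee
      · exact Or.inr ⟨h, hee⟩
    · rintro (rfl | ⟨h, _⟩)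
      · exact he
      · exact h

/-- **Resampling one coordinate.**  If `w, w'` agree off `e` then
`Σ_ω weight w' ω · h ω = Σ_ω weight w ω · ((1 − w' e)·h(ω ∖ {e}) + w' e·h(insert e ω))`. [folklore] -/
theorem sum_weight_resample (w w' : α → ℝ) (e : α) (hww' : ∀ e', e' ≠ e → w' e' = w e') (h : Set α → ℝ) :
    ∑ ω : Set α, weight w' ω * h ω
      = ∑ ω : Set α, weight w ω * ((1 - w' e) * h (ω \ {e}) + w' e * h (insert e ω)) := by
  rw [sum_pairs (fun ω => weight w' ω * h ω) e, sum_pairs (fun ω => weight w ω * ((1 - w' e) * h (ω \ {e}) + w' e * h (insert e ω))) e]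
  refine Finset.sum_congr rfl fun η hη => ?_
  have he : e ∉ η := by simpa using hη
  -- common rest factor
  set R := ∏ e' ∈ (Finset.univ : Finset α).erase e, (if e' ∈ η then w e' else 1 - w e') with hR
  have r1 : ∏ e' ∈ (Finset.univ : Finset α).erase e, (if e' ∈ η then w' e' else 1 - w' e') = R :=
    prod_erase_congr w w' e hww' η η (fun _ _ => Iff.rfl)
  have hins : ∀ e', e' ≠ e → (e' ∈ insert e η ↔ e' ∈ η) := fun e' hne => by
    simp only [Set.mem_insert_iff, hne, false_or]
  have r2 := prod_erase_congr w w' e hww' η (insert e η) hins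
  have r3 := prod_erase_congr w w e (fun _ _ => rfl) η (insert e η) hins
  have hmem : e ∈ insert e η := Set.mem_insert e η
  have w1 : weight w' η = (1 - w' e) * R := by rw [weight_eq_mul_erase w' e, if_neg he, r1]
  have w2 : weight w' (insert e η) = w' e * R := by rw [weight_eq_mul_erase w' e, if_pos hmem, r2]
  have w3 : weight w η = (1 - w e) * R := by rw [weight_eq_mul_erase w e, if_neg he]
  have w4 : weight w (insert e η) = w e * R := by rw [weight_eq_mul_erase w e, if_pos hmem, r3]
  have s1 : η \ {e} = η := by
    ext e'; simp only [Set.mem_sdiff, Set.mem_singleton_iff]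
    exact ⟨fun h => h.1, fun h => ⟨h, fun hee => he (hee ▸ h)⟩⟩
  have s2 : insert e η \ {e} = η := by
    ext e'; simp only [Set.mem_sdiff, Set.mem_insert_iff, Set.mem_singleton_iff]
    constructor
    · rintro ⟨rfl | h, hne⟩
      · exact absurd rfl hne
      · exact h
    · intro h; exact ⟨Or.inr h, fun hee => he (hee ▸ h)⟩
  have s3 : insert e (insert e η) = insert e η := Set.insert_eq_of_mem hmem
  rw [w1, w2, w3, w4, s1, s2, s3]
  ring

/-- A `{0,1}`-valued parameter vector puts all the weight on the configuration `{e | w e = 1}`. [folklore] -/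
theorem sum_weight_indicator (w : α → ℝ) (A : Set α) (hw : ∀ e, w e = if e ∈ A then 1 else 0) (h : Set α → ℝ) :
    ∑ ω : Set α, weight w ω * h ω = h A := by
  have hA : weight w A = 1 := by
    unfold weight
    refine Finset.prod_eq_one fun e _ => ?_
    by_cases he : e ∈ A
    · rw [if_pos he, hw e, if_pos he]
    · rw [if_neg he, hw e, if_neg he]; ring
  have hother : ∀ ω : Set α, ω ≠ A → weight w ω = 0 := by
    intro ω hω
    have : ∃ e, ¬ (e ∈ ω ↔ e ∈ A) := by
      by_contra hall
      exact hω (Set.ext fun e => by simpa using not_exists.mp hall e)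
    obtain ⟨e, he⟩ := this
    unfold weight
    refine Finset.prod_eq_zero (Finset.mem_univ e) ?_
    by_cases h1 : e ∈ ω
    · have h2 : e ∉ A := fun h2 => he ⟨fun _ => h2, fun _ => h1⟩
      rw [if_pos h1, hw e, if_neg h2]
    · have h2 : e ∈ A := by
        by_contra h2; exact he ⟨fun h => absurd h h1, fun h => absurd h h2⟩
      rw [if_neg h1, hw e, if_pos h2]; ring
  rw [Finset.sum_eq_single A (fun ω _ hω => by rw [hother ω hω, zero_mul]) (fun h => absurd (Finset.mem_univ A) h), hA,
    one_mul]

end Weights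

section Bridge

variable {ι V : Type*} [DecidableEq ι] [Fintype V] [DecidableEq V]

/-- **The multigraph sub-cube bridge.**  For `ends : ι → Sym2 V`, disjoint edge sets `B₀` (surely open) and `E₁` (free) and the product parameters
`w(e) = 1` if `e ∈ ends '' B₀`, else `1 − 2^{−#{i ∈ E₁ : ends i = e}}`:
  `Σ_{t ⊆ E₁} φ(ends '' (B₀ ∪ t)) = 2^{|E₁|} · Σ_ω BHK2006.weight w ω · φ ω`.
[cite: VandenbergHaggstromKahn2005, §1 p. 2 (bond percolation with arbitrary edge probabilities `p_e`)] -/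
theorem sum_subcube_eq_weight (ends : ι → Sym2 V) (B₀ E₁ : Finset ι) (hdis : Disjoint B₀ E₁) (φ : Set (Sym2 V) → ℝ) :
    ∑ t ∈ E₁.powerset, φ (↑((B₀ ∪ t).image ends) : Set (Sym2 V))
      = (2 : ℝ) ^ E₁.card * ∑ ω : Set (Sym2 V),
          weight (fun e => if e ∈ B₀.image ends then (1 : ℝ)
            else 1 - (1 / 2 : ℝ) ^ (E₁.filter (fun i => ends i = e)).card) ω * φ ω := by
  induction E₁ using Finset.induction_on generalizing φ with
  | empty =>
    simp only [Finset.powerset_empty, Finset.sum_singleton, Finset.union_empty, Finset.card_empty, pow_zero, one_mul]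
    symm
    refine sum_weight_indicator _ (↑(B₀.image ends) : Set (Sym2 V)) (fun e => ?_) φ
    by_cases he : e ∈ B₀.image ends
    · rw [if_pos he, if_pos (Finset.mem_coe.2 he)]
    · rw [if_neg he, if_neg (fun h => he (Finset.mem_coe.1 h))]
      simp
  | insert i E₁ hi IH =>
    have hdis' : Disjoint B₀ E₁ := Finset.disjoint_of_subset_right (Finset.subset_insert i E₁) hdis
    have hiB : i ∉ B₀ := fun h => Finset.disjoint_left.1 hdis h (Finset.mem_insert_self i E₁)
    set e := ends i with he
    set w : Sym2 V → ℝ := fun e' => if e' ∈ B₀.image ends then (1 : ℝ)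
        else 1 - (1 / 2 : ℝ) ^ (E₁.filter (fun j => ends j = e')).card with hw
    set w' : Sym2 V → ℝ := fun e' => if e' ∈ B₀.image ends then (1 : ℝ)
        else 1 - (1 / 2 : ℝ) ^ ((insert i E₁).filter (fun j => ends j = e')).card with hw'
    change ∑ t ∈ (insert i E₁).powerset, φ (↑((B₀ ∪ t).image ends) : Set (Sym2 V))
      = (2 : ℝ) ^ (insert i E₁).card * ∑ ω : Set (Sym2 V), weight w' ω * φ ω
    -- `w'` agrees with `w` off `e`, and at `e`
    have hww' : ∀ e', e' ≠ e → w' e' = w e' := by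
      intro e' hne
      have : (insert i E₁).filter (fun j => ends j = e') = E₁.filter (fun j => ends j = e') := by
        rw [Finset.filter_insert, if_neg (fun h : ends i = e' => hne (h ▸ he))]
      simp only [hw, hw', this]
    have himg : ∀ t : Finset ι, (↑((B₀ ∪ insert i t).image ends) : Set (Sym2 V)) = insert e ↑((B₀ ∪ t).image ends) := by
      intro t
      rw [Finset.union_insert, Finset.image_insert, Finset.coe_insert]
    -- split the powerset of `insert i E₁`
    rw [Finset.sum_powerset_insert hi]
    simp only [himg]
    rw [IH hdis' φ, IH hdis' (fun ω => φ (insert e ω)), Finset.card_insert_of_notMem hi, pow_succ]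
    -- resample the coordinate `e` (three times: for `w'` with `φ`, for `w` with `φ` and with `φ ∘ insert e`)
    rw [sum_weight_resample w w' e hww' φ, sum_weight_resample w w e (fun _ _ => rfl) φ,
      sum_weight_resample w w e (fun _ _ => rfl) (fun ω => φ (insert e ω))]
    have hins1 : ∀ ω : Set (Sym2 V), insert e (ω \ {e}) = insert e ω := fun ω => by
      ext e'; simp only [Set.mem_insert_iff, Set.mem_sdiff, Set.mem_singleton_iff]; tauto
    have hins2 : ∀ ω : Set (Sym2 V), insert e (insert e ω) = insert e ω := fun ω =>
      Set.insert_eq_of_mem (Set.mem_insert e ω)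
    simp only [hins1, hins2]
    rw [mul_assoc, ← mul_add]
    congr 1
    rw [Finset.mul_sum, ← Finset.sum_add_distrib]
    refine Finset.sum_congr rfl fun ω _ => ?_
    -- the parameter at `e`: `w' e = (1 + w e)/2`
    have hcoef : 1 - w e = 2 * (1 - w' e) ∧ 1 + w e = 2 * w' e := by
      by_cases hB : e ∈ B₀.image ends
      · have hwe : w e = 1 := by simp only [hw, hB, if_true]
        have hwe' : w' e = 1 := by simp only [hw', hB, if_true]
        rw [hwe, hwe']; norm_num
      · have hfilt : (insert i E₁).filter (fun j => ends j = e) = insert i (E₁.filter (fun j => ends j = e)) := by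
          rw [Finset.filter_insert, if_pos he.symm]
        have hnot : i ∉ E₁.filter (fun j => ends j = e) := fun h => hi (Finset.mem_filter.1 h).1
        have hwe : w e = 1 - (1 / 2 : ℝ) ^ (E₁.filter (fun j => ends j = e)).card := by simp only [hw, hB, if_false]
        have hwe' : w' e = 1 - (1 / 2 : ℝ) ^ ((E₁.filter (fun j => ends j = e)).card + 1) := by
          simp only [hw', hB, if_false, hfilt, Finset.card_insert_of_notMem hnot]
        rw [hwe, hwe', pow_succ]
        constructor <;> ring
    obtain ⟨c1, c2⟩ := hcoef
    have : weight w ω * ((1 - w e) * φ (ω \ {e}) + w e * φ (insert e ω))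
        + weight w ω * ((1 - w e) * φ (insert e ω) + w e * φ (insert e ω))
        = weight w ω * ((1 - w e) * φ (ω \ {e}) + (1 + w e) * φ (insert e ω)) := by ring
    rw [this, c1, c2]
    ring

end Bridge

end Coefficientwise

end Summit.CriticalPhenomena.PercolationContinuityZ3.Theorems
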